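import Summits.BirchSwinnertonDyer.BirchSwinnertonDyer.Theses.ErratumRoadFive
import Summits.BirchSwinnertonDyer.BirchSwinnertonDyer.Theorems.ErratumRoadFiveRest3ShaAnCertificate
import Summits.BirchSwinnertonDyer.Rank1Residual.X11b.BDPRouteEndState
import HarnessLib

/-!
# Route `ErratumRoadFive` (rung K2, `p ≥ 5`), crux `RamNoErratumDataAtFive` (item stmt-BirchSwinnertonDyer-19624, REST‴):
# EXACTNESS — the crux IS the main-conjecture half `ord_p #Ш(E)_an ≤ ord_p #Ш(E)` of `BSD(E,p)` on its pairs
# (cell `bsd-stepL`, owner seat `bsd-stepL-rest-p2` g4; `--supports stmt-BirchSwinnertonDyer-19624`; THEOREMS ONLY — no definition,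
# no named fact, no `sorry`)

HONEST FRAMING. Bookkeeping: modulo the route's support items `PublishedInputsFive` (19066) and `JSWAnticyclotomicControlMult`
(19626), the crux `RamNoErratumDataAtFive` (REST‴), its registered regime stubs `stub_rest3_locus` / `stub_rest3_tam` (skeleton v2
d79431634e7b) and its branch children `Rest3TorsionBranchAtFive` (19702) / `Rest3NoWitnessBranchAtFive` (19703) are each
EQUIVALENT to the lower half `Typed.MissingLowerBoundAt W p` (`#Ш(E)_an = q ∈ ℚ ∧ ord_p q ≤ ord_p #Ш(E)`) demanded at their own
pairs (X11b, `p ≥ 5`, `ρ̄` onto, a (ram) witness, the branch condition). Direction ⟸ is imc-p1's one-sided tightness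
(`openInputOnTreeAt_of_missingLowerBoundAt_of_ram_of_thm331Mult`, p432484; JSW17 Thm. 3.3.1-mult by citation); direction ⟹ is
multr1-p2 gen 13's `P2.missingLowerBoundAt_of_openInputAt` (`X11b/BDPRouteEndState.lean`: Gross–Zagier, Kolyvagin, Wuthrich 2014
Prop. 21, GZK, modularity, newform, Hoffstein–Luo, Mazur's Manin constant, Poitou–Tate, local Euler characteristic — all conjuncts of
`PublishedInputsFive`). So, as TYPED, item 19624 is neither weaker nor stronger than «the `p`-part of BSD from below at every REST‴
pair»: it holds iff no REST‴ pair has `ord_p #Ш(E) < ord_p #Ш(E)_an`; granted BSD it is true, and it is refutable only by a BSD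
counterexample. Per pair the lower half is CERTIFIED by the datum `ord_p #Ш(E)_an ≤ 0` (`missingLowerBoundAt_of_shaAn_nonpos`,
p512402; census HOME/rest/SHA-CENSUS-REST3.md: 703 204 ∕ 703 204 pairs `N < 5·10⁵`, two engines). CONDITIONAL on the two support
items; BSD is proved for no pair; nothing booked; no census word moves (T7).

* §1 `missingLowerBound_onRest3_of_ramNoErratumDataAtFive` (⟹), `ramNoErratumDataAtFive_of_missingLowerBound_onRest3` (⟸),
  `ramNoErratumDataAtFive_iff_missingLowerBound_onRest3` (⟺); `ramNoErratumDataAtFive_of_bsdp_onRest3` (BSD ⟹ crux, by name).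
* §2 the same `iff` for the two registered stubs and the two branch children.

References: [Miller2011LMS] Def. 1.1; [JetchevSkinnerWan2017] Thm. 3.3.1, §7.4.1; [Castella2018] Thms. 2.3, 3.2; [Wuthrich2014]
Prop. 21; [Skinner2016PacificMC] Thm. C; [Castella2018Erratum] Thm. 1.1 (iii)–(iv), (2.4); [Mazur1978] Cor. 4.1; [HoffsteinLuo1997].
-/

-- the Theorems namespace of this sub repeats the summit name by design (D-0017 nested layout)
set_option linter.dupNamespace false
set_option autoImplicit false

noncomputable section

open scoped Classical

namespace Summit.BirchSwinnertonDyer.BirchSwinnertonDyer.Theorems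

open WeierstrassCurve NumberField Literature.NumberTheory.EllipticCurves
  Literature.NumberTheory.EllipticCurves.Rank1Residual
  Literature.NumberTheory.EllipticCurves.Rank1Residual.Typed
  Summit.BirchSwinnertonDyer.Rank1Residual Summit.BirchSwinnertonDyer.Rank1Residual.X11b
  Summit.BirchSwinnertonDyer.BirchSwinnertonDyer.Theses.ErratumRoadFive

/-! ## §1 The crux ⟺ the lower half of `BSD(E,p)` on the REST‴ pairs -/

/-- **⟹: the crux gives the lower half at every REST‴ pair.** `PublishedInputsFive` + `RamNoErratumDataAtFive` ⟹ at every X11b pair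
with `p ≥ 5`, `ρ̄` onto, a (ram) witness and no erratum datum: `Typed.MissingLowerBoundAt W p`. Proof: the crux delivers the open
input at the pair; multr1-p2's `P2.missingLowerBoundAt_of_openInputAt` (GZ, Kolyvagin, Wuthrich 2014 Prop. 21, GZK, modularity,
newform, Hoffstein–Luo, Mazur, Poitou–Tate, local Euler characteristic — conjuncts 1, 2, 5–9, 11, 14, 15 of `PublishedInputsFive`) turns
it into the lower half. CONDITIONAL; nothing booked. [cite: Wuthrich2014, Prop. 21 (p. 400)] [cite: Castella2018, Thm. 2.3 (p. 5), Thm. 3.2 (p. 9)]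
[cite: JetchevSkinnerWan2017, §7.4.1 (pp. 30–31)] [cite: Mazur1978, Cor. 4.1] [cite: Miller2011LMS, Def. 1.1] -/
theorem missingLowerBound_onRest3_of_ramNoErratumDataAtFive
    (hF : PublishedInputsFive) (hR : RamNoErratumDataAtFive) :
    ∀ (W : WeierstrassCurve ℚ) [W.IsElliptic] [W.IsGloballyMinimal] (p : ℕ) [Fact p.Prime],
      ClassX11b W p → 5 ≤ p → Rank1Residual.Surj W p → Rank1Residual.Ram W p →
      ¬ ((∃ (q : ℕ) (_ : Fact q.Prime), q ≠ 2 ∧ q ≠ p ∧ Rank1Residual.Mult W q ∧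
          ¬ W.HasSplitMultiplicativeReductionAtPrime q ∧ ¬ p ∣ padicValInt q W.minimalDiscriminantInt) ∧
        (∀ P : (W.baseChange ℚ_[p]).toAffine.Point, p • P = 0 → P = 0)) →
      Typed.MissingLowerBoundAt W p := by
  obtain ⟨hGZ, hKo, -, -, hWu, hGZK, hmod, hnf, hHL, -, hMaz, -, -, hPT, hEP⟩ := hF
  intro W _ _ p _ hX hp5 hsurj hram hno
  exact P2.missingLowerBoundAt_of_openInputAt W p hGZ hKo hWu hGZK hmod hnf hHL hMaz hPT hEP (hR W p hram hno) hX hp5 hsurj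

/-- **⟸: the lower half at every REST‴ pair gives the crux** (imc-p1's one-sided tightness, by the route's names):
`PublishedInputsFive` + `JSWAnticyclotomicControlMult` + `hlow` ⟹ `RamNoErratumDataAtFive`. CONDITIONAL; nothing booked.
[cite: JetchevSkinnerWan2017, Thm. 3.3.1 with §3.5 (3.5.c), §7.4.1] [cite: Skinner2016PacificMC, Thm. C (§1)] [cite: Castella2018Erratum, Thm. 1.1 (iii)–(iv)] -/
theorem ramNoErratumDataAtFive_of_missingLowerBound_onRest3
    (hF : PublishedInputsFive) (h331 : JSWAnticyclotomicControlMult)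
    (hlow : ∀ (W : WeierstrassCurve ℚ) [W.IsElliptic] [W.IsGloballyMinimal] (p : ℕ) [Fact p.Prime],
      ClassX11b W p → 5 ≤ p → Rank1Residual.Surj W p → Rank1Residual.Ram W p →
      ¬ ((∃ (q : ℕ) (_ : Fact q.Prime), q ≠ 2 ∧ q ≠ p ∧ Rank1Residual.Mult W q ∧
          ¬ W.HasSplitMultiplicativeReductionAtPrime q ∧ ¬ p ∣ padicValInt q W.minimalDiscriminantInt) ∧
        (∀ P : (W.baseChange ℚ_[p]).toAffine.Point, p • P = 0 → P = 0)) →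
      Typed.MissingLowerBoundAt W p) :
    RamNoErratumDataAtFive := by
  obtain ⟨hGZ, hKo, -, hSk, -, hGZK, hmod, -, -, -, -, -, -, -, -⟩ := hF
  intro W _ _ p _ hram hno
  refine p2OpenInputOnTreeAt_of_imp_surj W p fun hX hp5 hsj ↦ ?_
  exact openInputOnTreeAt_of_missingLowerBoundAt_of_ram_of_thm331Mult W p h331 hGZ hKo hSk hGZK hmod hram
    (hlow W p hX hp5 hsj hram hno)

/-- **EXACTNESS of item 19624.** Modulo `PublishedInputsFive` and `JSWAnticyclotomicControlMult`: `RamNoErratumDataAtFive` ⟺ the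
main-conjecture half `ord_p #Ш(E)_an ≤ ord_p #Ш(E)` of `BSD(E,p)` (`Typed.MissingLowerBoundAt W p`) at EVERY X11b pair with `p ≥ 5`,
`ρ̄` onto, a (ram) witness and no erratum datum. So the item, as typed, is exactly «the p-part of BSD from below on the REST‴ pairs»
— true granted BSD, refutable only by a BSD counterexample, certified per pair by `ord_p #Ш(E)_an ≤ 0` (703 204 ∕ 703 204 pairs
`N < 5·10⁵`). CONDITIONAL on the two support items; nothing booked. [cite: Miller2011LMS, Def. 1.1] [cite: JetchevSkinnerWan2017, Thm. 3.3.1, §7.4.1]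
[cite: Wuthrich2014, Prop. 21 (p. 400)] [cite: Castella2018Erratum, Thm. 1.1 (iii)–(iv), (2.4)] -/
theorem ramNoErratumDataAtFive_iff_missingLowerBound_onRest3
    (hF : PublishedInputsFive) (h331 : JSWAnticyclotomicControlMult) :
    RamNoErratumDataAtFive ↔
      ∀ (W : WeierstrassCurve ℚ) [W.IsElliptic] [W.IsGloballyMinimal] (p : ℕ) [Fact p.Prime],
        ClassX11b W p → 5 ≤ p → Rank1Residual.Surj W p → Rank1Residual.Ram W p →
        ¬ ((∃ (q : ℕ) (_ : Fact q.Prime), q ≠ 2 ∧ q ≠ p ∧ Rank1Residual.Mult W q ∧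
            ¬ W.HasSplitMultiplicativeReductionAtPrime q ∧ ¬ p ∣ padicValInt q W.minimalDiscriminantInt) ∧
          (∀ P : (W.baseChange ℚ_[p]).toAffine.Point, p • P = 0 → P = 0)) →
        Typed.MissingLowerBoundAt W p :=
  ⟨missingLowerBound_onRest3_of_ramNoErratumDataAtFive hF, ramNoErratumDataAtFive_of_missingLowerBound_onRest3 hF h331⟩

/-- **Granted `BSD(E,p)` at every REST‴ pair, the crux holds** (by the route's names; multr1-p2's `P2.openInputOnTreeAt_of_bsdp_of_ram`
class-wide): `PublishedInputsFive` + `JSWAnticyclotomicControlMult` + `BSDp W p` on the REST‴ pairs ⟹ `RamNoErratumDataAtFive`. The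
converse is NOT claimed (the upper half needs the route's other inputs). ONE-SIDED TIGHTNESS; CONDITIONAL; nothing booked.
[cite: Miller2011LMS, Def. 1.1] [cite: JetchevSkinnerWan2017, Thm. 3.3.1, §7.4.1] -/
theorem ramNoErratumDataAtFive_of_bsdp_onRest3
    (hF : PublishedInputsFive) (h331 : JSWAnticyclotomicControlMult)
    (hB : ∀ (W : WeierstrassCurve ℚ) [W.IsElliptic] [W.IsGloballyMinimal] (p : ℕ) [Fact p.Prime],
      ClassX11b W p → 5 ≤ p → Rank1Residual.Surj W p → Rank1Residual.Ram W p →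
      ¬ ((∃ (q : ℕ) (_ : Fact q.Prime), q ≠ 2 ∧ q ≠ p ∧ Rank1Residual.Mult W q ∧
          ¬ W.HasSplitMultiplicativeReductionAtPrime q ∧ ¬ p ∣ padicValInt q W.minimalDiscriminantInt) ∧
        (∀ P : (W.baseChange ℚ_[p]).toAffine.Point, p • P = 0 → P = 0)) →
      BSDp W p) :
    RamNoErratumDataAtFive := by
  have hGZK : rank_eq_analyticRank_of_analyticRank_le_one := hF.2.2.2.2.2.1
  refine ramNoErratumDataAtFive_of_missingLowerBound_onRest3 hF h331 fun W _ _ p _ hX hp5 hsj hram hno ↦ ?_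
  haveI : Finite W.sha := (hGZK W hX.1.le).2
  exact (lower_and_upper_of_missingPPartAt W p (missingPPartAt_of_bsdp W p (hB W p hX hp5 hsj hram hno))).1

/-! ## §2 The same exactness for the registered stubs and the branch children -/

/-- **`stub_rest3_locus` (registered, VERBATIM) ⟺ the lower half on the Locus REST‴ pairs** (`p ∤ ∏ c_ℓ`), modulo the two support
items. CONDITIONAL; nothing booked. [cite: JetchevSkinnerWan2017, Thm. 3.3.1, §7.4.1] [cite: SkinnerZhang2014, Thm. 1.3 (the Locus road, PRE)] -/
theorem rest3Locus_iff_missingLowerBound_onLocus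
    (hF : PublishedInputsFive) (h331 : JSWAnticyclotomicControlMult) :
    (∀ (W : WeierstrassCurve ℚ) [W.IsElliptic] [W.IsGloballyMinimal] (p : ℕ) [Fact p.Prime],
      Literature.NumberTheory.EllipticCurves.Rank1Residual.Ram W p →
      ¬ ((∃ (q : ℕ) (_ : Fact q.Prime), q ≠ 2 ∧ q ≠ p ∧ Literature.NumberTheory.EllipticCurves.Rank1Residual.Mult W q ∧
          ¬ W.HasSplitMultiplicativeReductionAtPrime q ∧ ¬ p ∣ padicValInt q W.minimalDiscriminantInt) ∧
        (∀ P : (W.baseChange ℚ_[p]).toAffine.Point, p • P = 0 → P = 0)) →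
      ¬ p ∣ W.tamagawaProduct →
      Summit.BirchSwinnertonDyer.Rank1Residual.X11b.P2OpenInputOnTreeAt W p) ↔
    ∀ (W : WeierstrassCurve ℚ) [W.IsElliptic] [W.IsGloballyMinimal] (p : ℕ) [Fact p.Prime],
      ClassX11b W p → 5 ≤ p → Rank1Residual.Surj W p → Rank1Residual.Ram W p →
      ¬ ((∃ (q : ℕ) (_ : Fact q.Prime), q ≠ 2 ∧ q ≠ p ∧ Rank1Residual.Mult W q ∧
          ¬ W.HasSplitMultiplicativeReductionAtPrime q ∧ ¬ p ∣ padicValInt q W.minimalDiscriminantInt) ∧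
        (∀ P : (W.baseChange ℚ_[p]).toAffine.Point, p • P = 0 → P = 0)) →
      ¬ p ∣ W.tamagawaProduct → Typed.MissingLowerBoundAt W p := by
  obtain ⟨hGZ, hKo, -, hSk, hWu, hGZK, hmod, hnf, hHL, -, hMaz, -, -, hPT, hEP⟩ := hF
  constructor
  · intro hL W _ _ p _ hX hp5 hsurj hram hno htam
    exact P2.missingLowerBoundAt_of_openInputAt W p hGZ hKo hWu hGZK hmod hnf hHL hMaz hPT hEP (hL W p hram hno htam) hX hp5
      hsurj
  · intro hlow W _ _ p _ hram hno htam
    refine p2OpenInputOnTreeAt_of_imp_surj W p fun hX hp5 hsj ↦ ?_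
    exact openInputOnTreeAt_of_missingLowerBoundAt_of_ram_of_thm331Mult W p h331 hGZ hKo hSk hGZK hmod hram
      (hlow W p hX hp5 hsj hram hno htam)

/-- **`stub_rest3_tam` (REST⁗, registered, VERBATIM) ⟺ the lower half on the REST⁗ pairs** (`p ∣ ∏ c_ℓ`), modulo the two support
items. CONDITIONAL; nothing booked. [cite: JetchevSkinnerWan2017, Thm. 3.3.1, §7.4.1] [cite: Castella2018Erratum, Thm. 1.1 (iii)–(iv)] -/
theorem rest3Tam_iff_missingLowerBound_onTam
    (hF : PublishedInputsFive) (h331 : JSWAnticyclotomicControlMult) :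
    (∀ (W : WeierstrassCurve ℚ) [W.IsElliptic] [W.IsGloballyMinimal] (p : ℕ) [Fact p.Prime],
      Literature.NumberTheory.EllipticCurves.Rank1Residual.Ram W p →
      ¬ ((∃ (q : ℕ) (_ : Fact q.Prime), q ≠ 2 ∧ q ≠ p ∧ Literature.NumberTheory.EllipticCurves.Rank1Residual.Mult W q ∧
          ¬ W.HasSplitMultiplicativeReductionAtPrime q ∧ ¬ p ∣ padicValInt q W.minimalDiscriminantInt) ∧
        (∀ P : (W.baseChange ℚ_[p]).toAffine.Point, p • P = 0 → P = 0)) →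
      p ∣ W.tamagawaProduct →
      Summit.BirchSwinnertonDyer.Rank1Residual.X11b.P2OpenInputOnTreeAt W p) ↔
    ∀ (W : WeierstrassCurve ℚ) [W.IsElliptic] [W.IsGloballyMinimal] (p : ℕ) [Fact p.Prime],
      ClassX11b W p → 5 ≤ p → Rank1Residual.Surj W p → Rank1Residual.Ram W p →
      ¬ ((∃ (q : ℕ) (_ : Fact q.Prime), q ≠ 2 ∧ q ≠ p ∧ Rank1Residual.Mult W q ∧
          ¬ W.HasSplitMultiplicativeReductionAtPrime q ∧ ¬ p ∣ padicValInt q W.minimalDiscriminantInt) ∧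
        (∀ P : (W.baseChange ℚ_[p]).toAffine.Point, p • P = 0 → P = 0)) →
      p ∣ W.tamagawaProduct → Typed.MissingLowerBoundAt W p := by
  obtain ⟨hGZ, hKo, -, hSk, hWu, hGZK, hmod, hnf, hHL, -, hMaz, -, -, hPT, hEP⟩ := hF
  constructor
  · intro hT W _ _ p _ hX hp5 hsurj hram hno htam
    exact P2.missingLowerBoundAt_of_openInputAt W p hGZ hKo hWu hGZK hmod hnf hHL hMaz hPT hEP (hT W p hram hno htam) hX hp5
      hsurj
  · intro hlow W _ _ p _ hram hno htam
    refine p2OpenInputOnTreeAt_of_imp_surj W p fun hX hp5 hsj ↦ ?_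
    exact openInputOnTreeAt_of_missingLowerBoundAt_of_ram_of_thm331Mult W p h331 hGZ hKo hSk hGZK hmod hram
      (hlow W p hX hp5 hsj hram hno htam)

/-- **Branch (T) `Rest3TorsionBranchAtFive` (item 19702, BY NAME) ⟺ the lower half on the (T) pairs** (`E(ℚ_p)[p] ≠ 0`), modulo the
two support items. CONDITIONAL; nothing booked. [cite: JetchevSkinnerWan2017, Thm. 3.3.1, §7.4.1] [cite: Castella2018Erratum, Thm. 1.1 (iv)] -/
theorem rest3TorsionBranchAtFive_iff_missingLowerBound_onT
    (hF : PublishedInputsFive) (h331 : JSWAnticyclotomicControlMult) :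
    Rest3TorsionBranchAtFive ↔
      ∀ (W : WeierstrassCurve ℚ) [W.IsElliptic] [W.IsGloballyMinimal] (p : ℕ) [Fact p.Prime],
        ClassX11b W p → 5 ≤ p → Rank1Residual.Surj W p → Rank1Residual.Ram W p →
        (∃ P : (W.baseChange ℚ_[p]).toAffine.Point, p • P = 0 ∧ P ≠ 0) → Typed.MissingLowerBoundAt W p := by
  obtain ⟨hGZ, hKo, -, hSk, hWu, hGZK, hmod, hnf, hHL, -, hMaz, -, -, hPT, hEP⟩ := hF
  constructor
  · intro hT W _ _ p _ hX hp5 hsurj hram hP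
    exact P2.missingLowerBoundAt_of_openInputAt W p hGZ hKo hWu hGZK hmod hnf hHL hMaz hPT hEP (hT W p hram hP) hX hp5 hsurj
  · intro hlow W _ _ p _ hram hP
    refine p2OpenInputOnTreeAt_of_imp_surj W p fun hX hp5 hsj ↦ ?_
    exact openInputOnTreeAt_of_missingLowerBoundAt_of_ram_of_thm331Mult W p h331 hGZ hKo hSk hGZK hmod hram
      (hlow W p hX hp5 hsj hram hP)

/-- **Branch (NW) `Rest3NoWitnessBranchAtFive` (item 19703, BY NAME) ⟺ the lower half on the (NW) pairs** (`E(ℚ_p)[p] = 0`, no odd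
non-split `E[p]`-ramified multiplicative `q ≠ p`), modulo the two support items. CONDITIONAL; nothing booked.
[cite: JetchevSkinnerWan2017, Thm. 3.3.1, §7.4.1] [cite: Castella2018Erratum, Thm. 1.1 (iii)] -/
theorem rest3NoWitnessBranchAtFive_iff_missingLowerBound_onNW
    (hF : PublishedInputsFive) (h331 : JSWAnticyclotomicControlMult) :
    Rest3NoWitnessBranchAtFive ↔
      ∀ (W : WeierstrassCurve ℚ) [W.IsElliptic] [W.IsGloballyMinimal] (p : ℕ) [Fact p.Prime],
        ClassX11b W p → 5 ≤ p → Rank1Residual.Surj W p → Rank1Residual.Ram W p →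
        (∀ P : (W.baseChange ℚ_[p]).toAffine.Point, p • P = 0 → P = 0) →
        ¬ (∃ (q : ℕ) (_ : Fact q.Prime), q ≠ 2 ∧ q ≠ p ∧ Rank1Residual.Mult W q ∧
            ¬ W.HasSplitMultiplicativeReductionAtPrime q ∧ ¬ p ∣ padicValInt q W.minimalDiscriminantInt) →
        Typed.MissingLowerBoundAt W p := by
  obtain ⟨hGZ, hKo, -, hSk, hWu, hGZK, hmod, hnf, hHL, -, hMaz, -, -, hPT, hEP⟩ := hF
  constructor
  · intro hN W _ _ p _ hX hp5 hsurj hram htors hno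
    exact P2.missingLowerBoundAt_of_openInputAt W p hGZ hKo hWu hGZK hmod hnf hHL hMaz hPT hEP (hN W p hram htors hno) hX hp5
      hsurj
  · intro hlow W _ _ p _ hram htors hno
    refine p2OpenInputOnTreeAt_of_imp_surj W p fun hX hp5 hsj ↦ ?_
    exact openInputOnTreeAt_of_missingLowerBoundAt_of_ram_of_thm331Mult W p h331 hGZ hKo hSk hGZK hmod hram
      (hlow W p hX hp5 hsj hram htors hno)

end Summit.BirchSwinnertonDyer.BirchSwinnertonDyer.Theorems

end
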